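import Mathlib
import Summits.MatrixMultiplication.MatrixMultiplication.Theses.SnSubsetDichotomy
import Literature.Barriers.MatrixMultiplication.NilpotentGroupBarrierSemisimple
import Summits.MatrixMultiplication.MatrixMultiplication.Theorems.SnSubsetDichotomyNoThresholdSubsetTripleStubTransfer

/-!
# Line `hyperoctahedral-heredity-superdecay` for crux `SnSubsetDichotomy.JuntaBranch`
# (stmt-MatrixMultiplication-8304) — crux-strategist (wall-breaker) line, 2026-08-17

The crux as filed is `∀ ε ∀ c` and ANTITONE in `c`; every combinatorial improvement mechanism is
dead (descent caps p88826, planting self-defeat p99111, costume residuals p89951/p107214), and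
every vacuity tool at the Vershik–Kerov scale `e^{-c₂√n}` (CKSU, pivot sieves, the `p = 2` KLR
grading of crux 8302's live line, numerically `e^{-0.021√n}`) is silent for `c ≥ c₂`.  The only
strategy class that reaches a `∀ c` statement is SUPER-`√n` VACUITY from an invariant that is NOT
tied to `d_max(S_n)`: a modular slice-rank saving `slice-rank_{𝔽₂} D_{S_n} ≤ n!·e^{-C√n}` for
EVERY `C` gives `SuperDecay` (no TPP triple of `S_n` reaches `(n!)^{3/2}e^{-c√n}`, for every `c`),
and `SuperDecay ⇒ JuntaBranch` vacuously (cdisprove `withoutBump_iff_superDecay`).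

Mechanism (Blasiak–Church–Cohn–Grochow–Umans 2017 = arXiv:1712.02302, §5 p. 11: "this would follow
from extending Lemma (lem:normal) to non-normal subgroups, since `S_n` has (non-normal) `p`-subgroups
of size `exp(Θ(n))`"), made specific to the route's knife-edge hosts:

* `stub_hostSaving` (L, provable): the hyperoctahedral groups `B_m = C_2 ≀ S_m = C_{S_{2m}}(μ)`
  (centralizers of fixed-point-free involutions; for odd `n`, of involutions with one fixed point)
  have an EXPONENTIAL modular slice-rank saving `slice-rank_{𝔽₂} D_{B_m} ≤ |B_m|·e^{-δn}`:
  BCCGU Lemma 3.x (`lem:normal`, p. 8) with the NORMAL elementary abelian base `N = C_2^m ⊴ B_m`,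
  `I = J = ω^{⌈m/3⌉}` (powers of the augmentation ideal of `𝔽₂[N] ≅ 𝔽₂[y]/(yᵢ²)`, the unique
  maximal ideal — characteristic), `IJ = ω^{2⌈m/3⌉}`, and the binomial tails (the CLEP/Tao capset
  count on `𝔽₂^m`) `2·Σ_{i<m/3} C(m,i) + Σ_{i≥2m/3} C(m,i) ≤ 3·2^{H(1/3)m} = 3·2^{0.918m}`, give
  `≤ m!·3·2^{0.918m} = |B_m|·3·2^{-0.082m} ≈ |B_m|·e^{-0.028n}`.
* `stub_heredity` (CONJECTURE-GRADE — the crux of this line): slice-rank heredity with polynomial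
  loss for the pair `(S_n, C(μ))`: `slice-rank_{𝔽₂} D_{S_n} ≤ A·n^B·[S_n : C(μ)]·slice-rank_{𝔽₂} D_{C(μ)}`.
  BCCGU §5 pose exactly this extension; even black-box heredity for NORMAL subgroups is open
  (ibid. p. 11), and the codimension-method proof of Lemma 3.x does not extend (the two-sided
  ideal of `𝔽₂[S_n]` generated by `ω(𝔽₂[C_2^m])` is the whole augmentation ideal).  A proof gives
  `slice-rank_{𝔽₂} D_{S_n} ≤ A n^B · n! · e^{-δn}` — an `e^{-Ω(n)}` saving, far beyond threshold.
* transfer `superDecay_of_superSaving` (PROVED here): `∀ C`-saving ⇒ `SuperDecay`, by packing in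
  three rotations, the balanced sub-triple `⟨N,N,N⟩` and `N² ≤ slice-rank` (BCCGU Prop. B.6, tree
  theorem `BCCGU2017_propB6.sq_le_sliceRank_of_realizesTPP`), as in `Theorems.stub_transfer` (p73506).

Other glue PROVED here: `exists_involution_le_one_fixed` (the pairing `2k ↔ 2k+1`),
`superSaving_of_host_of_heredity` (`A n^B e^{-δn} ≤ e^{-C√n}` eventually, `[S_n:H]·|H| = n!`),
`juntaBranch_statement_of_superDecay` (vacuity), and the composition `JuntaBranch_of` (hypothesis-free,
using the two registered stubs by name).
-/

set_option linter.dupNamespace false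

namespace Summit.MatrixMultiplication.MatrixMultiplication.Cruxes.JuntaBranch.HyperoctahedralHereditySuperdecay

open Literature.Barriers.MatrixMultiplication Literature.Combinatorics.Additive
open Literature.Computability.AlgebraicComplexity
open Summit.MatrixMultiplication.MatrixMultiplication.Theses.SnSubsetDichotomy
open scoped Classical

/-! ## Registered stubs -/

/-- **Stub S1 (`stub_hostSaving`, L, provable now modulo vendoring BCCGU 2017 Lemma 3.x).**
Exponential `𝔽₂`-slice-rank saving for the hyperoctahedral hosts: for large `n`, every involution
`μ` of `Fin n` with at most one fixed point has
`slice-rank_{𝔽₂} D_{C(μ)} ≤ |C(μ)|·e^{-δn}` (`C(μ) ≅ C_2 ≀ S_{⌊n/2⌋}`; BCCGU Lemma 3.x with the normal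
base `C_2^{⌊n/2⌋}`, `I = J = ω^{⌈m/3⌉}`, binomial tails = the CLEP count on `𝔽₂^m`). -/
theorem stub_hostSaving :
    ∃ δ : ℝ, 0 < δ ∧ ∃ n₀ : ℕ, ∀ n ≥ n₀, ∀ μ : Equiv.Perm (Fin n), μ * μ = 1 →
      (Finset.univ.filter (fun x => μ x = x)).card ≤ 1 →
      (sliceRank (mulGroupTensor (ZMod 2)
          ↥(Subgroup.centralizer ({μ} : Set (Equiv.Perm (Fin n))))) : ℝ) ≤
        (Nat.card ↥(Subgroup.centralizer ({μ} : Set (Equiv.Perm (Fin n)))) : ℝ) *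
          Real.exp (-(δ * n)) := by
  sorry

/-- **Stub S2 (`stub_heredity`, CONJECTURE-GRADE — the crux of the line).**  Slice-rank heredity
with polynomial loss from the hyperoctahedral host to the symmetric group: there are `A > 0` and
`B` with `slice-rank_{𝔽₂} D_{S_n} ≤ A·n^B·[S_n : C(μ)]·slice-rank_{𝔽₂} D_{C(μ)}` for every `n ≥ 1`
and every involution `μ` with at most one fixed point (Blasiak–Church–Cohn–Grochow–Umans 2017 §5,
the non-normal extension of Lemma 3.x, instance `G = S_n`, `H = C_2 ≀ S_{⌊n/2⌋}`). -/
theorem stub_heredity :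
    ∃ A B : ℝ, 0 < A ∧ ∀ n : ℕ, 1 ≤ n → ∀ μ : Equiv.Perm (Fin n), μ * μ = 1 →
      (Finset.univ.filter (fun x => μ x = x)).card ≤ 1 →
      (sliceRank (mulGroupTensor (ZMod 2) (Equiv.Perm (Fin n))) : ℝ) ≤
        A * (n : ℝ) ^ B * ((Subgroup.centralizer ({μ} : Set (Equiv.Perm (Fin n)))).index : ℝ) *
          (sliceRank (mulGroupTensor (ZMod 2)
            ↥(Subgroup.centralizer ({μ} : Set (Equiv.Perm (Fin n))))) : ℝ) := by
  sorry

/-! ## Glue (proved) -/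

/-- **Transfer (PROVED; was stub S3 of the plan): super-`√n` saving ⇒ `SuperDecay`.**  A modular
slice-rank saving for `S_n` at EVERY rate `C` (eventually `slice-rank_{𝔽₂} D_{S_n} ≤ n!·e^{-C√n}`)
gives `SuperDecay`: for every `c`, eventually NO TPP triple of subsets of `S_n` reaches
`(n!)^{3/2}e^{-c√n}` (packing in three rotations, balanced sub-triple, `N² ≤ slice-rank` by BCCGU 2017
Prop. B.6 = tree theorem `BCCGU2017_propB6.sq_le_sliceRank_of_realizesTPP`; take `C := 2c + 2` and
square the floor).  Same mechanism as `Theorems.stub_transfer` (p73506) with the constant threaded. -/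
theorem superDecay_of_superSaving :
    (∀ C : ℝ, 0 < C → ∃ n₀ : ℕ, ∀ n ≥ n₀,
      (sliceRank (mulGroupTensor (ZMod 2) (Equiv.Perm (Fin n))) : ℝ) ≤
        (n.factorial : ℝ) * Real.exp (-(C * Real.sqrt (n : ℝ)))) →
    ∀ c : ℝ, 0 < c → ∃ n₀ : ℕ, ∀ n ≥ n₀, ∀ S T U : Finset (Equiv.Perm (Fin n)),
      TripleProductProperty S T U →
      ((S.card * T.card * U.card : ℕ) : ℝ) <
        (n.factorial : ℝ) ^ ((3 : ℝ) / 2) * Real.exp (-(c * Real.sqrt (n : ℝ))) := by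
  intro hC c hc
  obtain ⟨n₀, hn₀⟩ := hC (2 * c + 2) (by linarith)
  refine ⟨max n₀ 1, fun n hn S T U hTPP => ?_⟩
  have hnn₀ : n₀ ≤ n := le_of_max_le_left hn
  have hn1 : 1 ≤ n := le_of_max_le_right hn
  by_contra hge
  rw [not_lt] at hge
  have hf : (0 : ℝ) < (n.factorial : ℝ) := by exact_mod_cast Nat.factorial_pos n
  have hs : 0 < Real.sqrt (n : ℝ) := Real.sqrt_pos.2 (by exact_mod_cast hn1)
  -- (i) the three sets are non-empty
  have hprod : 0 < S.card * T.card * U.card := by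
    have h0 : (0 : ℝ) < ((S.card * T.card * U.card : ℕ) : ℝ) :=
      lt_of_lt_of_le (by positivity) hge
    exact_mod_cast h0
  have hS0 : S.card ≠ 0 := fun h0 => by simp [h0] at hprod
  have hT0 : T.card ≠ 0 := fun h0 => by simp [h0] at hprod
  have hU0 : U.card ≠ 0 := fun h0 => by simp [h0] at hprod
  -- (ii) packing in three rotations: `V ≤ N · n!` for the minimum `N`
  have hNprod :=
    Summit.MatrixMultiplication.MatrixMultiplication.Theorems.tpp_perm_card_mul_le_min_mul_factorial
      hTPP hS0 hT0 hU0
  have hNS : min S.card (min T.card U.card) ≤ S.card := min_le_left _ _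
  have hNT : min S.card (min T.card U.card) ≤ T.card := (min_le_right _ _).trans (min_le_left _ _)
  have hNU : min S.card (min T.card U.card) ≤ U.card :=
    (min_le_right _ _).trans (min_le_right _ _)
  generalize min S.card (min T.card U.card) = N at hNprod hNS hNT hNU
  -- (iii) balanced sub-triple: `N² ≤ slice-rank_{𝔽₂} D_{S_n} ≤ n!·e^{-(2c+2)√n}`
  have hR : RealizesTPP (Equiv.Perm (Fin n)) N N N :=
    Summit.MatrixMultiplication.MatrixMultiplication.Theorems.tpp_perm_realizesTPP_of_le hTPP hNS hNT hNU
  have hsq : ((N : ℝ)) ^ 2 ≤ (sliceRank (mulGroupTensor (ZMod 2) (Equiv.Perm (Fin n))) : ℝ) := by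
    exact_mod_cast BCCGU2017_propB6.sq_le_sliceRank_of_realizesTPP BCCGU2017_propB6_holds (ZMod 2)
      (Equiv.Perm (Fin n)) hR
  have hN2 : ((N : ℝ)) ^ 2 ≤
      (n.factorial : ℝ) * Real.exp (-((2 * c + 2) * Real.sqrt (n : ℝ))) := hsq.trans (hn₀ n hnn₀)
  -- (iv) real bookkeeping: square the floor, compare exponents
  set f : ℝ := (n.factorial : ℝ) with hfdef
  set s : ℝ := Real.sqrt (n : ℝ) with hsdef
  set V : ℝ := ((S.card * T.card * U.card : ℕ) : ℝ) with hVdef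
  have hVN : V ≤ (N : ℝ) * f := by rw [hVdef, hfdef]; exact_mod_cast hNprod
  have hV0 : 0 ≤ V := by positivity
  have h32 : f ^ ((3 : ℝ) / 2) = f * Real.sqrt f := by
    rw [Real.rpow_div_two_eq_sqrt _ hf.le, Real.rpow_ofNat, pow_succ, Real.sq_sqrt hf.le]
  have hrpow : (f ^ ((3 : ℝ) / 2)) ^ 2 = f ^ 3 := by
    rw [h32, mul_pow, Real.sq_sqrt hf.le]; ring
  have hE : Real.exp (-(c * s)) ^ 2 = Real.exp (-(2 * c * s)) := by
    rw [sq, ← Real.exp_add]; congr 1; ring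
  have hlow : f ^ 3 * Real.exp (-(2 * c * s)) ≤ V ^ 2 := by
    have h := pow_le_pow_left₀ (by positivity) hge 2
    rw [mul_pow, hrpow, hE] at h
    exact h
  have hup : V ^ 2 ≤ f ^ 3 * Real.exp (-((2 * c + 2) * s)) := by
    calc V ^ 2 ≤ ((N : ℝ) * f) ^ 2 := pow_le_pow_left₀ hV0 hVN 2
      _ = ((N : ℝ)) ^ 2 * f ^ 2 := by ring
      _ ≤ (f * Real.exp (-((2 * c + 2) * s))) * f ^ 2 :=
          mul_le_mul_of_nonneg_right hN2 (by positivity)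
      _ = f ^ 3 * Real.exp (-((2 * c + 2) * s)) := by ring
  have hcmp : f ^ 3 * Real.exp (-(2 * c * s)) ≤ f ^ 3 * Real.exp (-((2 * c + 2) * s)) :=
    hlow.trans hup
  have hf3 : 0 < f ^ 3 := by positivity
  have hexp := le_of_mul_le_mul_left hcmp hf3
  rw [Real.exp_le_exp] at hexp
  nlinarith [hexp, hs]

/-- For every `n` there is an involution of `Fin n` with at most one fixed point
(pair `2k ↔ 2k+1`; `n − 1` is fixed when `n` is odd). [folklore] -/
theorem exists_involution_le_one_fixed (n : ℕ) :
    ∃ μ : Equiv.Perm (Fin n), μ * μ = 1 ∧ (Finset.univ.filter (fun x => μ x = x)).card ≤ 1 := by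
  let f : Fin n → Fin n := fun i =>
    if i.val % 2 = 0 then (if h : i.val + 1 < n then ⟨i.val + 1, h⟩ else i)
    else ⟨i.val - 1, by omega⟩
  have hf : Function.Involutive f := by
    intro i
    obtain ⟨i, hi⟩ := i
    by_cases h0 : i % 2 = 0
    · by_cases h1 : i + 1 < n
      · have hA : f ⟨i, hi⟩ = ⟨i + 1, h1⟩ := by simp [f, h0, h1]
        have hodd : ¬ (i + 1) % 2 = 0 := by omega
        have hB : f ⟨i + 1, h1⟩ = ⟨i, hi⟩ := by
          simp only [f, hodd, ↓reduceIte]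
          ext
          simp
        rw [hA, hB]
      · have hA : f ⟨i, hi⟩ = ⟨i, hi⟩ := by simp [f, h0, h1]
        rw [hA, hA]
    · have h1 : i - 1 + 1 < n := by omega
      have hA : f ⟨i, hi⟩ = ⟨i - 1, by omega⟩ := by simp [f, h0]
      have heven : (i - 1) % 2 = 0 := by omega
      have hB : f ⟨i - 1, by omega⟩ = ⟨i, hi⟩ := by
        simp only [f, heven, ↓reduceIte]
        have : i - 1 + 1 < n := h1
        rw [dif_pos this]
        ext
        simp only
        omega
      rw [hA, hB]
  refine ⟨hf.toPerm f, ?_, ?_⟩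
  · ext x
    simp [Equiv.Perm.mul_apply, hf x]
  · refine Finset.card_le_one.2 fun a ha b hb => ?_
    simp only [Finset.mem_filter, Finset.mem_univ, true_and] at ha hb
    have key : ∀ c : Fin n, hf.toPerm f c = c → c.val % 2 = 0 ∧ ¬ c.val + 1 < n := by
      intro c hc
      obtain ⟨c, hc'⟩ := c
      change f ⟨c, hc'⟩ = ⟨c, hc'⟩ at hc
      by_cases h0 : c % 2 = 0
      · by_cases h1 : c + 1 < n
        · exfalso
          have : f ⟨c, hc'⟩ = ⟨c + 1, h1⟩ := by simp [f, h0, h1]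
          rw [this] at hc
          have := congrArg Fin.val hc
          simp at this
        · exact ⟨h0, h1⟩
      · exfalso
        have : f ⟨c, hc'⟩ = ⟨c - 1, by omega⟩ := by simp [f, h0]
        rw [this] at hc
        have := congrArg Fin.val hc
        simp at this
        omega
    obtain ⟨_, ha2⟩ := key a ha
    obtain ⟨_, hb2⟩ := key b hb
    ext
    have := a.isLt
    have := b.isLt
    omega

/-- Real bookkeeping: `A·n^B·e^{-δn} ≤ e^{-C√n}` for all large `n`. [folklore] -/
theorem poly_exp_le_exp_sqrt (A B δ C : ℝ) (hA : 0 < A) (hδ : 0 < δ) (hC : 0 < C) :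
    ∃ n₁ : ℕ, ∀ n : ℕ, n₁ ≤ n →
      A * (n : ℝ) ^ B * Real.exp (-(δ * n)) ≤ Real.exp (-(C * Real.sqrt (n : ℝ))) := by
  -- threshold: √n ≥ M := (2|B| + C + |log A| + 1)/δ, and n ≥ 1
  set M : ℝ := (2 * |B| + C + |Real.log A| + 1) / δ with hM
  have hM0 : 0 ≤ M := by
    rw [hM]; positivity
  refine ⟨⌈M ^ 2⌉₊ + 1, fun n hn => ?_⟩
  have hn1 : (1 : ℝ) ≤ n := by exact_mod_cast (Nat.le_add_left 1 _).trans hn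
  have hn0 : (0 : ℝ) < n := by linarith
  set s : ℝ := Real.sqrt (n : ℝ) with hs
  have hs1 : 1 ≤ s := by rw [hs]; exact Real.one_le_sqrt.2 hn1
  have hs0 : 0 < s := by linarith
  have hsM : M ≤ s := by
    have h1 : (M ^ 2 : ℝ) ≤ n := by
      have : (⌈M ^ 2⌉₊ : ℝ) ≤ n := by exact_mod_cast (Nat.le_succ _).trans hn
      exact (Nat.le_ceil _).trans this
    calc M = Real.sqrt (M ^ 2) := (Real.sqrt_sq hM0).symm
      _ ≤ s := Real.sqrt_le_sqrt h1
  -- compare logarithms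
  rw [← Real.log_le_log_iff (by positivity) (Real.exp_pos _), Real.log_exp,
    Real.log_mul (by positivity) (Real.exp_pos _).ne', Real.log_exp,
    Real.log_mul hA.ne' (by positivity), Real.log_rpow hn0]
  -- log n ≤ 2 s
  have hlogn : Real.log n ≤ 2 * s := by
    have h := Real.log_le_sub_one_of_pos hs0
    have : Real.log n = 2 * Real.log s := by
      rw [hs, Real.log_sqrt hn0.le]; ring
    rw [this]; linarith
  have hBlog : B * Real.log n ≤ 2 * |B| * s := by
    calc B * Real.log n ≤ |B * Real.log n| := le_abs_self _
      _ = |B| * |Real.log n| := abs_mul _ _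
      _ = |B| * Real.log n := by rw [abs_of_nonneg (Real.log_nonneg hn1)]
      _ ≤ |B| * (2 * s) := mul_le_mul_of_nonneg_left hlogn (abs_nonneg _)
      _ = 2 * |B| * s := by ring
  have hlogA : Real.log A ≤ |Real.log A| := le_abs_self _
  have hss : s * s = n := by rw [hs]; exact Real.mul_self_sqrt hn0.le
  -- δ s ≥ 2|B| + C + |log A| + 1
  have hkey : 2 * |B| + C + |Real.log A| + 1 ≤ δ * s := by
    have := mul_le_mul_of_nonneg_left hsM hδ.le
    rw [hM, mul_div_cancel₀ _ hδ.ne'] at this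
    exact this
  -- conclude: log A + B log n - δ n ≤ - C s
  have habs : 0 ≤ |Real.log A| := abs_nonneg _
  have habsB : 0 ≤ |B| := abs_nonneg _
  nlinarith [hkey, hBlog, hlogA, hss, hs1, habs, habsB, hC]

/-- **Glue: host saving + heredity ⇒ super-`√n` saving.**  With `[S_n : H]·|H| = n!` the two stubs
give `slice-rank_{𝔽₂} D_{S_n} ≤ A n^B · n! · e^{-δn} ≤ n!·e^{-C√n}` for every `C`, eventually. -/
theorem superSaving_of_host_of_heredity
    (h1 : ∃ δ : ℝ, 0 < δ ∧ ∃ n₀ : ℕ, ∀ n ≥ n₀, ∀ μ : Equiv.Perm (Fin n), μ * μ = 1 →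
      (Finset.univ.filter (fun x => μ x = x)).card ≤ 1 →
      (sliceRank (mulGroupTensor (ZMod 2)
          ↥(Subgroup.centralizer ({μ} : Set (Equiv.Perm (Fin n))))) : ℝ) ≤
        (Nat.card ↥(Subgroup.centralizer ({μ} : Set (Equiv.Perm (Fin n)))) : ℝ) *
          Real.exp (-(δ * n)))
    (h2 : ∃ A B : ℝ, 0 < A ∧ ∀ n : ℕ, 1 ≤ n → ∀ μ : Equiv.Perm (Fin n), μ * μ = 1 →
      (Finset.univ.filter (fun x => μ x = x)).card ≤ 1 →
      (sliceRank (mulGroupTensor (ZMod 2) (Equiv.Perm (Fin n))) : ℝ) ≤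
        A * (n : ℝ) ^ B * ((Subgroup.centralizer ({μ} : Set (Equiv.Perm (Fin n)))).index : ℝ) *
          (sliceRank (mulGroupTensor (ZMod 2)
            ↥(Subgroup.centralizer ({μ} : Set (Equiv.Perm (Fin n))))) : ℝ)) :
    ∀ C : ℝ, 0 < C → ∃ n₀ : ℕ, ∀ n ≥ n₀,
      (sliceRank (mulGroupTensor (ZMod 2) (Equiv.Perm (Fin n))) : ℝ) ≤
        (n.factorial : ℝ) * Real.exp (-(C * Real.sqrt (n : ℝ))) := by
  obtain ⟨δ, hδ, n₀, hS1⟩ := h1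
  obtain ⟨A, B, hA, hS2⟩ := h2
  intro C hC
  obtain ⟨n₁, hn₁⟩ := poly_exp_le_exp_sqrt A B δ C hA hδ hC
  refine ⟨max n₀ (max n₁ 1), fun n hn => ?_⟩
  have hn0 : n₀ ≤ n := le_of_max_le_left hn
  have hn1 : n₁ ≤ n := (le_max_left _ _).trans (le_of_max_le_right hn)
  have hn2 : 1 ≤ n := (le_max_right _ _).trans (le_of_max_le_right hn)
  obtain ⟨μ, hμ, hfix⟩ := exists_involution_le_one_fixed n
  set H := Subgroup.centralizer ({μ} : Set (Equiv.Perm (Fin n))) with hH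
  have hA' := hS2 n hn2 μ hμ hfix
  have hB' := hS1 n hn0 μ hμ hfix
  -- `[S_n : H] · |H| = n!`
  have hLag : (H.index : ℝ) * (Nat.card ↥H : ℝ) = (n.factorial : ℝ) := by
    have h := H.index_mul_card
    rw [Nat.card_eq_fintype_card (α := Equiv.Perm (Fin n)), Fintype.card_perm, Fintype.card_fin] at h
    exact_mod_cast h
  have hidx : 0 ≤ (H.index : ℝ) := Nat.cast_nonneg _
  have hpoly : 0 ≤ A * (n : ℝ) ^ B := by positivity
  calc (sliceRank (mulGroupTensor (ZMod 2) (Equiv.Perm (Fin n))) : ℝ)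
      ≤ A * (n : ℝ) ^ B * (H.index : ℝ) *
          (sliceRank (mulGroupTensor (ZMod 2) ↥H) : ℝ) := hA'
    _ ≤ A * (n : ℝ) ^ B * (H.index : ℝ) * ((Nat.card ↥H : ℝ) * Real.exp (-(δ * n))) :=
        mul_le_mul_of_nonneg_left hB' (mul_nonneg hpoly hidx)
    _ = (A * (n : ℝ) ^ B * Real.exp (-(δ * n))) * ((H.index : ℝ) * (Nat.card ↥H : ℝ)) := by ring
    _ = (A * (n : ℝ) ^ B * Real.exp (-(δ * n))) * (n.factorial : ℝ) := by rw [hLag]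
    _ ≤ Real.exp (-(C * Real.sqrt (n : ℝ))) * (n.factorial : ℝ) :=
        mul_le_mul_of_nonneg_right (hn₁ n hn1) (Nat.cast_nonneg _)
    _ = (n.factorial : ℝ) * Real.exp (-(C * Real.sqrt (n : ℝ))) := mul_comm _ _

/-- **Glue: `SuperDecay ⇒` (the statement of) `JuntaBranch`** (vacuity: at every `c` the volume floor
`(n!)^{3/2}e^{-c√n} ≤ |S||T||U|` of the crux is eventually never met).  The conclusion is the crux's
statement written out (definitionally equal to `JuntaBranch`), so that the only theorem of this file
concluding the crux BY NAME is the composition `JuntaBranch_of` below. -/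
theorem juntaBranch_statement_of_superDecay
    (hSD : ∀ c : ℝ, 0 < c → ∃ n₀ : ℕ, ∀ n ≥ n₀, ∀ S T U : Finset (Equiv.Perm (Fin n)),
      TripleProductProperty S T U →
      ((S.card * T.card * U.card : ℕ) : ℝ) <
        (n.factorial : ℝ) ^ ((3 : ℝ) / 2) * Real.exp (-(c * Real.sqrt (n : ℝ)))) :
    ∀ ε : ℝ, 0 < ε → ∀ c : ℝ, 0 < c → ∃ n₀ : ℕ, ∀ n ≥ n₀, ∀ S T U : Finset (Equiv.Perm (Fin n)),
      TripleProductProperty S T U →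
      (n.factorial : ℝ) ^ ((3 : ℝ) / 2) * Real.exp (-(c * Real.sqrt (n : ℝ))) ≤
        ((S.card * T.card * U.card : ℕ) : ℝ) →
      (∃ X : Finset (Equiv.Perm (Fin n)), (X = S ∨ X = T ∨ X = U) ∧ ∃ t : ℕ, 1 ≤ t ∧
        (t : ℝ) ≤ Real.sqrt (n : ℝ) ∧ ∃ I L : Fin t → Fin n, Function.Injective I ∧
        Function.Injective L ∧ (n : ℝ) ^ ((1 / 2 + ε) * t) * (X.card : ℝ) <
          ((X.filter (fun σ => ∀ k, σ (I k) = L k)).card : ℝ) * (n.descFactorial t : ℝ)) →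
      ∃ n' : ℕ, (n : ℝ) - Real.sqrt (n : ℝ) ≤ (n' : ℝ) ∧ n' < n ∧
        ∃ S' T' U' : Finset (Equiv.Perm (Fin n')), TripleProductProperty S' T' U' ∧
          Real.exp (c + 1) * ((S.card * T.card * U.card : ℕ) : ℝ) *
              ((n'.factorial : ℝ) / (n.factorial : ℝ)) ^ ((3 : ℝ) / 2) ≤
            ((S'.card * T'.card * U'.card : ℕ) : ℝ) := by
  intro ε _ c hc
  obtain ⟨n₀, h⟩ := hSD c hc
  refine ⟨n₀, fun n hn S T U hTPP hLarge _ => ?_⟩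
  exact absurd hLarge (not_le.2 (h n hn S T U hTPP))

/-! ## Composition -/

/-- **The line's composition** (skeleton shape: no hypotheses, the two REGISTERED STUBS are used by
name): host saving (`stub_hostSaving`) and heredity (`stub_heredity`) prove the crux `JuntaBranch`
BY NAME — through the super-`√n` modular slice-rank saving (`superSaving_of_host_of_heredity`),
`SuperDecay` (`superDecay_of_superSaving`) and vacuity (`juntaBranch_statement_of_superDecay`). -/
theorem JuntaBranch_of :
    Summit.MatrixMultiplication.MatrixMultiplication.Theses.SnSubsetDichotomy.JuntaBranch :=
  juntaBranch_statement_of_superDecay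
    (superDecay_of_superSaving (superSaving_of_host_of_heredity stub_hostSaving stub_heredity))

end Summit.MatrixMultiplication.MatrixMultiplication.Cruxes.JuntaBranch.HyperoctahedralHereditySuperdecay
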